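import Literature.NumberTheory.NumberFields.CMFieldTwoRankOfTotPosSquares
import Literature.NumberTheory.NumberFields.NarrowClassNumberRingEquiv
import Literature.NumberTheory.NumberFields.AdjoinSqrtNegOneRamificationAtTwo
import Literature.NumberTheory.IwasawaTheory.CyclotomicTwoTotallyRamifiedEighthRoot
import Mathlib.NumberTheory.NumberField.CMField
import HarnessLib

/-!
# Horie's Lemma 1 (ii) for `K = K⁺(√−1)` with ONE prime of `K⁺` above `2`:
# `#Cl_K[2] = #(U⁺/U²)(K⁺) = h⁺(K⁺)/h(K⁺)` — the `2`-rank of the class group of `K` IS the narrow defect of `K⁺`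

Topic `NumberTheory/NumberFields` (namespace = path).  THEOREM-ONLY file (no definition, no named fact, no instance, no `sorry`),
written by the prover seat `bsd-2adic-k4-w1` GEN 9 (cell `bsd-2adic`; `--supports` stmt-BirchSwinnertonDyer-22615).  Companion of
`CMFieldAmbiguousClassNumber.lean` §6 (Horie 1994, Lemma 1 (ii): for a CM field `K` with `h(K⁺)` odd and AT MOST ONE finite prime of `K⁺`
ramified in `K`, `E_{K⁺} ∩ N_{K/K⁺}Kˣ = E⁺_{K⁺}` and `#Cl_K[2] · h(K⁺) = h⁺(K⁺)`), specialised to the shape met along the cyclotomic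
`ℤ₂`-tower of `K⁺(√−1)`: `K ∋ √−1`, so `K/K⁺` is unramified away from `2` (tree `ramificationIdxIn_eq_one_of_two_not_mem`), and the ONE
prime `v₀` of `K⁺` above `2` ramifies in `K` as soon as the primes of `K` above `2` carry a power of `2` in `e(·|2)` that `[K⁺:ℚ]` (hence
`e(v₀|2) ∣ [K⁺:ℚ]`) does not: `2 ∣ e` from `√−1 ∈ K` when `[K⁺:ℚ]` is odd, `4 ∣ e` from `ζ₈ ∈ K` when `[K⁺:ℚ] = 2·odd`
(tree `four_dvd_ramificationIdx_int_of_pow_four_eq_neg_one`).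

* §1 transport along ring isomorphisms: `existsUnique_natCast_mem_of_ringEquiv` (exactly one prime above `p`),
  `card_totPosUnitsModSq_eq_of_ringEquiv` (`#(U⁺/U²)`).
* §2 `ramificationIdxIn_eq_two_of_pow_dvd_of_not_pow_dvd` — `[L:K] = 2` Galois; if `2^{k+1} ∣ e(Q|2)` for every prime `Q ∣ 2` of `L`
  and `2^{k+1} ∤ e(𝔭|2)` for a prime `𝔭 ∣ 2` of `K`, then `e(𝔭, L/K) = 2` (the `k = 0` case is the tree's
  `ramificationIdxIn_eq_two_of_odd_ramificationIdx`).
* §3 **`IsCMField.natCard_twoTorsion_classGroup_eq_card_totPosUnitsModSq_of_sq_eq_neg_one`** — `K` CM with `x² = −1` in `𝓞 K`,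
  `h(K⁺)` odd, exactly one prime of `K⁺` above `2`, `2^{k+1} ∣ e(Q|2)` for the primes `Q ∣ 2` of `K`, `2^{k+1} ∤ [K⁺:ℚ]` ⟹
  **`#Cl_K[2] = #(U⁺/U²)(K⁺)`** and `#Cl_K[2] · h(K⁺) = h⁺(K⁺)`.  So `rank₂ Cl_K = ord₂ h⁺(K⁺) − ord₂ h(K⁺)`, the NARROW DEFECT
  of the maximal real subfield: the `2`-class group of `K⁺(√−1)` is read off the unit signatures of `K⁺` ALONE.

HONEST SCOPE.  Classical statements; nothing specific to any summit.  Consumed by the two-layer Horie–Fukuda criterion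
(`Literature/NumberTheory/IwasawaTheory/ClassicalMuVanishesAdjoinIOfNarrowDefectLayerOne.lean`).  BSD is not proved by any of this.

References: [Horie1994] K. Horie, *On CM-fields with the same maximal real subfield*, Acta Arith. 67 (1994), §1 Lemma 1 (ii) with proof;
[Okazaki2000] §3 Lemma 17; [NeukirchANT1999] Ch. I §8 Prop. (8.2), Ch. III Thm. (2.6); [Washington1997] Thm. 10.1.
-/

set_option autoImplicit false

noncomputable section

open scoped NumberField
open NumberField NumberField.IsCMField IsDedekindDomain Module

namespace Literature.NumberTheory.NumberFields

open Literature.NumberTheory.GaloisRepresentations Literature.NumberTheory.IwasawaTheory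
  Literature.Geometry.Kaehler.ComplexTorus

/-! ## §1 Transport along ring isomorphisms -/

section Transport

variable {A A' : Type} [Field A] [NumberField A] [Field A'] [NumberField A']

omit [NumberField A] [NumberField A'] in
/-- `g ∘ algebraMap ℤ = algebraMap ℤ` for a ring isomorphism of rings of integers. [folklore] -/
private theorem ringEquiv_comp_algebraMap_int' (g : 𝓞 A ≃+* 𝓞 A') :
    (g : 𝓞 A →+* 𝓞 A').comp (algebraMap ℤ (𝓞 A)) = algebraMap ℤ (𝓞 A') :=
  RingHom.ext_int _ _

omit [NumberField A] [NumberField A'] in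
/-- **«Exactly one prime above `p`» is invariant under isomorphism of number fields** (pull primes back along
`𝓞 A' ≃ 𝓞 A`). [cite: Marcus2018, Ch. 4 (before Thm. 29)] -/
theorem existsUnique_natCast_mem_of_ringEquiv (e : A ≃+* A') (p : ℕ)
    (h : ∃! v : HeightOneSpectrum (𝓞 A), ((p : ℕ) : 𝓞 A) ∈ v.asIdeal) :
    ∃! v' : HeightOneSpectrum (𝓞 A'), ((p : ℕ) : 𝓞 A') ∈ v'.asIdeal := by
  set g : 𝓞 A ≃+* 𝓞 A' := RingOfIntegers.mapRingEquiv e with hg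
  obtain ⟨v, hv, huniq⟩ := h
  haveI := v.isPrime
  -- the pull-back of `v` along `g⁻¹`
  have hprime : (v.asIdeal.comap (g.symm : 𝓞 A' →+* 𝓞 A)).IsPrime := Ideal.comap_isPrime _ _
  have hne : v.asIdeal.comap (g.symm : 𝓞 A' →+* 𝓞 A) ≠ ⊥ := by
    intro hbot
    apply v.ne_bot
    have := congrArg (Ideal.comap (g : 𝓞 A →+* 𝓞 A')) hbot
    rw [Ideal.comap_comap, show (g.symm : 𝓞 A' →+* 𝓞 A).comp (g : 𝓞 A →+* 𝓞 A') = RingHom.id _ from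
      RingHom.ext fun x => g.symm_apply_apply x, Ideal.comap_id] at this
    rw [this]; exact Ideal.comap_bot_of_injective (g : 𝓞 A →+* 𝓞 A') (fun a b h => g.injective h)
  refine ⟨⟨_, hprime, hne⟩, ?_, fun w' hw' => ?_⟩
  · change ((p : ℕ) : 𝓞 A') ∈ v.asIdeal.comap (g.symm : 𝓞 A' →+* 𝓞 A)
    rw [Ideal.mem_comap, RingHom.coe_coe, map_natCast]; exact hv
  · -- `w' ∩ 𝓞 A` (pulled back along `g`) is a prime above `p`, hence `v`
    haveI := w'.isPrime
    have hwne : w'.asIdeal.comap (g : 𝓞 A →+* 𝓞 A') ≠ ⊥ := by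
      intro hbot
      apply w'.ne_bot
      have := congrArg (Ideal.comap (g.symm : 𝓞 A' →+* 𝓞 A)) hbot
      rw [Ideal.comap_comap, show (g : 𝓞 A →+* 𝓞 A').comp (g.symm : 𝓞 A' →+* 𝓞 A) = RingHom.id _ from
        RingHom.ext fun x => g.apply_symm_apply x, Ideal.comap_id] at this
      rw [this]; exact Ideal.comap_bot_of_injective (g.symm : 𝓞 A' →+* 𝓞 A) (fun a b h => g.symm.injective h)
    have hw : ((p : ℕ) : 𝓞 A) ∈ (⟨_, Ideal.comap_isPrime (g : 𝓞 A →+* 𝓞 A') w'.asIdeal, hwne⟩ :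
        HeightOneSpectrum (𝓞 A)).asIdeal := by
      change ((p : ℕ) : 𝓞 A) ∈ w'.asIdeal.comap (g : 𝓞 A →+* 𝓞 A')
      rw [Ideal.mem_comap, RingHom.coe_coe, map_natCast]; exact hw'
    have hwv := huniq _ hw
    apply HeightOneSpectrum.ext
    have hId : v.asIdeal = w'.asIdeal.comap (g : 𝓞 A →+* 𝓞 A') := (congrArg HeightOneSpectrum.asIdeal hwv).symm
    change w'.asIdeal = v.asIdeal.comap (g.symm : 𝓞 A' →+* 𝓞 A)
    rw [hId, Ideal.comap_comap, show (g : 𝓞 A →+* 𝓞 A').comp (g.symm : 𝓞 A' →+* 𝓞 A) = RingHom.id _ from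
      RingHom.ext fun x => g.apply_symm_apply x, Ideal.comap_id]

/-- **`#(U⁺/U²)` is invariant under isomorphism of totally real number fields** (`h⁺ = h · #(U⁺/U²)` on both sides,
`h⁺` and `h` are invariant). [cite: FrohlichTaylor1990, Ch. V §1 (1.12), p. 164] -/
theorem card_totPosUnitsModSq_eq_of_ringEquiv [IsTotallyReal A] [IsTotallyReal A'] (e : A ≃+* A') :
    Nat.card (TotPosUnitsModSq A) = Nat.card (TotPosUnitsModSq A') := by
  have h1 := narrowClassNumber_eq_classNumber_mul_card_totPosUnitsModSq (K := A)
  have h2 := narrowClassNumber_eq_classNumber_mul_card_totPosUnitsModSq (K := A')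
  rw [narrowClassNumber_eq_of_ringEquiv e, classNumber_eq_of_ringEquiv e, h2] at h1
  exact (Nat.eq_of_mul_eq_mul_left (classNumber_pos A') h1).symm

end Transport

/-! ## §2 `e(𝔭, L/K) = 2` from a power of `2` dividing `e(·|2)` upstairs but not downstairs -/

section Relative

variable {K L : Type} [Field K] [NumberField K] [Field L] [NumberField L] [Algebra K L]

/-- **`e(𝔭, L/K) = 2` (and one prime above `𝔭`)** for `[L : K] = 2` Galois and a prime `𝔭 ∣ 2` of `K`, when some power `2^{k+1}`
divides `e(Q|2)` for every prime `Q ∣ 2` of `L` but does not divide `e(𝔭|2)`: for `Q` over `𝔭`, `e(Q|2) = e(𝔭|2)·e(Q|𝔭)` forces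
`e(Q|𝔭) ≠ 1`, and `e(Q|𝔭) ∣ [L:K] = 2`.  (`k = 0`: the tree's `ramificationIdxIn_eq_two_of_odd_ramificationIdx`; `k = 1` is fed by
`ζ₈ ∈ L`, `four_dvd_ramificationIdx_int_of_pow_four_eq_neg_one`.) [cite: NeukirchANT1999, Ch. I §8 Prop. (8.2)]
[cite: Marcus2018, Ch. 4 (e and f are multiplicative in towers)] -/
theorem ramificationIdxIn_eq_two_of_pow_dvd_of_not_pow_dvd [IsGalois K L] (h2 : Module.finrank K L = 2) (k : ℕ)
    (hup : ∀ (Q : Ideal (𝓞 L)) [Q.IsPrime] [Q.LiesOver (Ideal.span {(2 : ℤ)})], 2 ^ (k + 1) ∣ Q.ramificationIdx ℤ)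
    (p : Ideal (𝓞 K)) [p.IsPrime] [p.LiesOver (Ideal.span {(2 : ℤ)})]
    (hdown : ¬ 2 ^ (k + 1) ∣ p.ramificationIdx ℤ) :
    p.ramificationIdxIn (𝓞 L) = 2 ∧ (p.primesOver (𝓞 L)).ncard = 1 := by
  classical
  have h2ne : (Ideal.span {(2 : ℤ)} : Ideal ℤ) ≠ ⊥ := by rw [Ne, Ideal.span_singleton_eq_bot]; norm_num
  have hp0 : p ≠ ⊥ := Ideal.ne_bot_of_liesOver_of_ne_bot h2ne p
  haveI := (inferInstance : p.IsPrime).isMaximal hp0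
  obtain ⟨P, hPmax, hPover⟩ := Ideal.exists_maximal_ideal_liesOver_of_isIntegral (S := 𝓞 L) p
  haveI := hPmax
  haveI := hPover
  haveI : P.LiesOver (Ideal.span {(2 : ℤ)}) := Ideal.LiesOver.trans P p _
  have hP2 : P.under (𝓞 K) = p := (Ideal.over_def P p).symm
  have htower : P.ramificationIdx ℤ = p.ramificationIdx ℤ * P.ramificationIdx (𝓞 K) := by
    have h := Ideal.ramificationIdx_tower (P.under (𝓞 K)) P (R := ℤ)
    rwa [hP2] at h
  have hupP := hup P
  rw [htower] at hupP
  -- the fundamental identity `g · (e · f) = 2`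
  have hfund := Ideal.ncard_primesOver_mul_ramificationIdxIn_mul_inertiaDegIn p (𝓞 L) (L ≃ₐ[K] L)
  rw [IsGalois.card_aut_eq_finrank, h2, Ideal.ramificationIdxIn_eq_ramificationIdx p P (L ≃ₐ[K] L)] at hfund
  have hedvd : P.ramificationIdx (𝓞 K) ∣ 2 :=
    ⟨(p.primesOver (𝓞 L)).ncard * p.inertiaDegIn (𝓞 L), by rw [← hfund]; ring⟩
  have he2 : P.ramificationIdx (𝓞 K) = 2 := by
    rcases (Nat.dvd_prime Nat.prime_two).mp hedvd with h | h
    · rw [h, mul_one] at hupP; exact absurd hupP hdown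
    · exact h
  refine ⟨by rw [Ideal.ramificationIdxIn_eq_ramificationIdx p P (L ≃ₐ[K] L), he2], ?_⟩
  rw [he2] at hfund
  have hgf : (p.primesOver (𝓞 L)).ncard * p.inertiaDegIn (𝓞 L) = 1 := by linarith
  exact Nat.eq_one_of_mul_eq_one_right hgf

end Relative

/-! ## §3 Horie (ii) for `K = K⁺(√−1)` with one prime of `K⁺` above `2` -/

section Horie

variable (K : Type) [Field K] [NumberField K] [IsCMField K]

/-- `√−1 ∉ K⁺` (a totally real field has no square root of `−1`), so `K = K⁺(x)` for `x² = −1` in `K`: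
`Algebra.adjoin K⁺ {x} = ⊤`. [cite: Washington1997, §13 (CM fields), Thm. 10.1] -/
theorem IsCMField.adjoin_eq_top_of_sq_eq_neg_one {x : 𝓞 K} (hx : x ^ 2 = -1) :
    Algebra.adjoin (maximalRealSubfield K) {((x : 𝓞 K) : K)} = ⊤ := by
  set y : K := ((x : 𝓞 K) : K) with hy
  have hy2 : y ^ 2 = -1 := by
    have h := congrArg (fun t : 𝓞 K => (t : K)) hx
    push_cast at h
    rw [hy]; exact h
  -- `y ∉ K⁺`: a real embedding would send `y²` to a square equal to `−1`
  have hnot : y ∉ (algebraMap (maximalRealSubfield K) K).range := by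
    rintro ⟨w, hw⟩
    obtain ⟨w₀⟩ := (inferInstance : Nonempty (InfinitePlace (maximalRealSubfield K)))
    set σ : maximalRealSubfield K →+* ℝ := InfinitePlace.embedding_of_isReal (IsTotallyReal.isReal w₀)
    have h1 : (σ w) ^ 2 = -1 := by
      rw [← map_pow]
      have : w ^ 2 = -1 := by
        apply (algebraMap (maximalRealSubfield K) K).injective
        rw [map_pow, hw, hy2, map_neg, map_one]
      rw [this, map_neg, map_one]
    nlinarith [sq_nonneg (σ w)]
  have hyint : IsIntegral (maximalRealSubfield K) y := (Algebra.IsIntegral.isIntegral (R := ℚ) y).tower_top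
  have h2le : 2 ≤ (minpoly (maximalRealSubfield K) y).natDegree := (minpoly.two_le_natDegree_iff hyint).mpr hnot
  have hdeg : Module.finrank (maximalRealSubfield K) K = 2 := (IsCMField.isQuadraticExtension K).finrank_eq_two
  have htop : IntermediateField.adjoin (maximalRealSubfield K) ({y} : Set K) = ⊤ := by
    refine IntermediateField.eq_of_le_of_finrank_eq le_top ?_
    rw [IntermediateField.adjoin.finrank hyint, IntermediateField.finrank_top', hdeg]
    refine le_antisymm ?_ h2le
    rw [← hdeg, ← IntermediateField.finrank_top', ← IntermediateField.adjoin.finrank hyint]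
    exact IntermediateField.finrank_le_of_le_right le_top
  rw [← IntermediateField.adjoin_simple_toSubalgebra_of_isAlgebraic hyint.isAlgebraic, htop, IntermediateField.top_toSubalgebra]

/-- **Horie 1994, Lemma 1 (ii), for `K = K⁺(√−1)` with ONE prime of `K⁺` above `2`: `#Cl_K[2] = #(U⁺/U²)(K⁺)` and
`#Cl_K[2] · h(K⁺) = h⁺(K⁺)`.**  `K` a CM number field containing `x` with `x² = −1`, `h(K⁺)` odd, `𝓞 K⁺` with exactly one prime `v₀`
above `2`; if for some `k` every prime `Q ∣ 2` of `K` has `2^{k+1} ∣ e(Q|2)` while `2^{k+1} ∤ [K⁺:ℚ]`, then `K/K⁺` is ramified exactly at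
`v₀` among the finite primes (`e(v₀|2) ∣ [K⁺:ℚ]` by the fundamental identity, so `2^{k+1} ∤ e(v₀|2)` and §2 applies; the primes `∌ 2`
are unramified since `K = K⁺(√−1)`), and Horie's Lemma 1 (ii) (tree `…_of_odd_of_isUnramifiedIn`: Chevalley's formula, Hilbert
reciprocity and Hasse's norm theorem giving `E ∩ N Kˣ = E⁺`) reads **`rank₂ Cl_K = ord₂ h⁺(K⁺) − ord₂ h(K⁺)`** — the narrow defect of `K⁺`.
Shapes: `k = 0` for `[K⁺:ℚ]` odd (`2 ∣ e(Q|2)` from `√−1`), `k = 1` for `[K⁺:ℚ] = 2·odd` with `ζ₈ ∈ K` (`4 ∣ e(Q|2)`).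
[cite: Horie1994, §1 Lemma 1 (ii) and its proof, formula (1.1)] [cite: Okazaki2000, §3 Lemma 17] [cite: NeukirchANT1999, Ch. I §8 Prop. (8.2), Ch. III Thm. (2.6)] -/
theorem IsCMField.natCard_twoTorsion_classGroup_eq_card_totPosUnitsModSq_of_sq_eq_neg_one {x : 𝓞 K} (hx : x ^ 2 = -1)
    (hodd : Odd (classNumber (maximalRealSubfield K)))
    (huniq : ∃! v : HeightOneSpectrum (𝓞 (maximalRealSubfield K)), ((2 : ℕ) : 𝓞 (maximalRealSubfield K)) ∈ v.asIdeal)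
    (k : ℕ) (hup : ∀ (Q : Ideal (𝓞 K)) [Q.IsPrime] [Q.LiesOver (Ideal.span {(2 : ℤ)})], 2 ^ (k + 1) ∣ Q.ramificationIdx ℤ)
    (hdown : ¬ 2 ^ (k + 1) ∣ Module.finrank ℚ (maximalRealSubfield K)) :
    Nat.card {c : ClassGroup (𝓞 K) // c ^ 2 = 1} = Nat.card (TotPosUnitsModSq (maximalRealSubfield K)) ∧
      Nat.card {c : ClassGroup (𝓞 K) // c ^ 2 = 1} * classNumber (maximalRealSubfield K) =
        narrowClassNumber (maximalRealSubfield K) := by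
  classical
  obtain ⟨v₀, hv₀, hv₀uniq⟩ := huniq
  haveI : v₀.asIdeal.IsPrime := v₀.isPrime
  have hv₀2 : (2 : 𝓞 (maximalRealSubfield K)) ∈ v₀.asIdeal := by exact_mod_cast hv₀
  haveI : v₀.asIdeal.LiesOver (Ideal.span {(2 : ℤ)}) := by
    rw [Ideal.liesOver_span_iff v₀.isPrime.ne_top Int.prime_two, map_ofNat]; exact hv₀2
  have hdeg : Module.finrank (maximalRealSubfield K) K = 2 := (IsCMField.isQuadraticExtension K).finrank_eq_two
  have hgen := IsCMField.adjoin_eq_top_of_sq_eq_neg_one K hx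
  -- `2^{k+1} ∤ e(v₀|2)` since `e(v₀|2) ∣ [K⁺:ℚ]`
  have hdown' : ¬ 2 ^ (k + 1) ∣ v₀.asIdeal.ramificationIdx ℤ := fun h =>
    hdown (h.trans (ramificationIdx_dvd_finrank_of_existsUnique_two_mem ⟨v₀, hv₀, hv₀uniq⟩ v₀ hv₀))
  -- `v₀` ramifies in `K`
  have hv₀ram : ¬ Algebra.IsUnramifiedIn (𝓞 K) v₀.asIdeal := by
    intro hunr
    have h1 := (IsCMField.ramificationIdxIn_eq_one_iff_isUnramifiedIn K v₀).mpr hunr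
    have h2 := (ramificationIdxIn_eq_two_of_pow_dvd_of_not_pow_dvd hdeg k hup v₀.asIdeal hdown').1
    rw [h1] at h2; exact absurd h2 (by norm_num)
  -- every other finite prime is unramified (`K = K⁺(√−1)`)
  have hunr : ∀ v : HeightOneSpectrum (𝓞 (maximalRealSubfield K)), v ≠ v₀ →
      Algebra.IsUnramifiedIn (𝓞 K) v.asIdeal := by
    intro v hv
    have hv2 : (2 : 𝓞 (maximalRealSubfield K)) ∉ v.asIdeal := fun h => hv (hv₀uniq v (by exact_mod_cast h))
    exact (IsCMField.ramificationIdxIn_eq_one_iff_isUnramifiedIn K v).mp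
      (ramificationIdxIn_eq_one_of_two_not_mem hx hgen v hv2)
  exact IsCMField.card_twoTorsion_classGroup_eq_card_totPosUnitsModSq_of_odd_of_isUnramifiedIn K hodd hv₀ram hunr

end Horie

end Literature.NumberTheory.NumberFields

end
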